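import Summits.BirchSwinnertonDyer.BirchSwinnertonDyer.Theorems.TwoAdicConverseTwoTorsionIsogenyPairsSemistable
import Summits.BirchSwinnertonDyer.BirchSwinnertonDyer.Theorems.TwoAdicConverseGoodTwistsKolyvaginBigImageLeaf
import Literature.NumberTheory.EllipticCurves.Greenberg1999.TwoTorsionQuadraticTwistPairTypeProofs
import HarnessLib

/-!
# Route `TwoAdicConverse` (rung S3), items 19218 / 19219 and the leaf: the ATOMS of stratum (β) under the
# `2`-isogeny `P ↦ P'` AND the admissible twists `d ≡ 1 (mod 4)` — three pieces, and `μ` along a twist family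

Cell `bsd-2adic` (run/shared/lean/pub/bsd-2adic/), seat `bsd-2adic-conv-1` (GEN 20).  THEOREMS ONLY — no
definition, no named fact, no `sorry`; `--supports stmt-BirchSwinnertonDyer-19218`.  HONEST FRAMING: BSD is not
proved by any of this; item 19218 and its research inputs stay OPEN; Greenberg's Props. 5.13 / 5.14 at `p = 2` are
PRINT facts displayed BY NAME (`h513`, `h514`), never proved here; nothing is booked.  PARTITION (D-0054): none —
RANK axis (S3), stratum (β) «`E(ℚ)[2] ≠ 0`» at a good-ordinary OR multiplicative `2`, and the quadratic-twist axis
of the S3 head line (Smith's admissible family `𝓕 = {d square-free, d ≡ 1 (mod 4)}`).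

conv-1 GEN 19/20 split (β) along `ℤ/2`-linked pairs into (M) «a Prop-5.14 point» and (R) «a Prop-5.13 point».
Neither (M) nor (R) is closed under `𝓕`: by the Literature companion `TwoTorsionQuadraticTwistPairTypeProofs`
(this GEN) a pair is of one of FOUR types — R₁ (pure, the 5.13 member has `Δ < 0`), M₁ (mixed, one member has
`Δ < 0`), R₂ (pure, both `Δ > 0`), M₂ (mixed, both `Δ > 0`) —, positive admissible twists preserve the type and
NEGATIVE admissible twists preserve R₁, M₁ and SWAP R₂ ↔ M₂.  Hence:

* §1 transport helpers: `padicValRat_two_intCast_of_emod_four_eq_one`, `goodOrd_or_mult_of_smul_eq_quadraticTwist`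
  (the CM-free half of `not_hasCM_and_goodOrd_or_mult_of_smul_eq_quadraticTwist`).
* §2 **`μ` is not constant on an admissible twist family off the habitat**: a curve with a Prop-5.13 point and
  `Δ > 0` (type R₂; `μ ≥ 1` here by 5.13, `h513`) acquires a Prop-5.14 point at EVERY negative admissible twist, where
  therefore `X(·/ℚ_∞)` is `Λ`-torsion with `μ = 0` BY NAME (`h514`):
  `isTorsion_mu_eq_zero_twist_of_neg_of_ramified_odd_of_Δ_pos`; conversely the ramified member of an M₂ pair
  (ramified, co-odd, not odd; `μ = 0` by 5.14) acquires a Prop-5.13 point, `μ ≥ 1`, at every negative admissible twist: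
  `one_le_mu_twist_of_neg_of_ramified_coodd`.  On R₁ / M₁ the relevant hypothesis persists along the whole family
  (`ramified_and_odd_twist_iff_of_Δ_neg`, `prop514Hypothesis_twist_iff_of_Δ_neg`, Literature).
* §3 the three member-level ATOMS of (β) — A₁ = «`Δ < 0` with a ramified point, or an unramified MIDDLE point» (all
  members of R₁ pairs), A₂ = «`Δ < 0` with an unramified point, or a ramified MIDDLE point» (all members of M₁ pairs),
  A₃ = «`Δ > 0` with an EXTREME (odd or co-odd) point» (all members of R₂ and M₂ pairs) — are `𝓕`-closed between
  minimal models (`atom₁_twist`, `atom₂_twist`, `atom₃_twist`), the input a twist-family (Smith) engine needs; A₁/A₂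
  keep even the distinguished point's configuration, A₃ only up to odd ↔ co-odd.  The companion file
  `TwoAdicConverseTwoTorsionAtoms` derives the (β) piece of the leaf / of item 19218 from the three atoms.

References: R. Greenberg, LNM 1716 (1999), §5 Props. 5.13–5.14 and Remarks pp. 120–124 [GreenbergLNM1716];
J. H. Silverman, *AEC*, III.1, III.4.5, VII.7.2, X.5.4 [SilvermanAEC2009]; A. Smith, arXiv:2503.17619 Thm. 1.1 (the
family `𝓕`) [arXiv250317619]; W. Zhang, Camb. J. Math. 2 (2014) Thm. 1.1 (shape) [WZhang2014].
-/

set_option linter.dupNamespace false  -- `BirchSwinnertonDyer.BirchSwinnertonDyer` is the sub's path (D-0017)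
set_option autoImplicit false

noncomputable section

open scoped Classical
open WeierstrassCurve Literature Literature.NumberTheory.EllipticCurves
  Literature.NumberTheory.EllipticCurves.ModularForms
  Literature.NumberTheory.EllipticCurves.Rank1Residual
  Literature.NumberTheory.EllipticCurves.Greenberg1999
  Summit.BirchSwinnertonDyer.BirchSwinnertonDyer.Theses.TwoAdicConverse
  Summit.BirchSwinnertonDyer.BirchSwinnertonDyer.Theorems.TwoAdicKolyvaginRankZero
  Summit.BirchSwinnertonDyer.BirchSwinnertonDyer.Theorems.TwoAdicGoodTwists

namespace Summit.BirchSwinnertonDyer.BirchSwinnertonDyer.Theorems.TwoAdicOffHabitat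

/-! ## §1 Transport helpers for an admissible twist -/

/-- `d ≡ 1 (mod 4)` is odd: `v₂(d) = 0`. [folklore] -/
theorem padicValRat_two_intCast_of_emod_four_eq_one {d : ℤ} (hd4 : d % 4 = 1) :
    padicValRat 2 ((d : ℤ) : ℚ) = 0 := by
  have hodd : ¬ ((2 : ℕ) : ℤ) ∣ d := by
    intro h
    obtain ⟨k, hk⟩ := h
    omega
  rw [padicValRat.of_int, padicValInt.eq_zero_of_not_dvd hodd, Nat.cast_zero]

variable (W : WeierstrassCurve ℚ) [W.IsElliptic] [W.IsGloballyMinimal]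

/-- **An admissible twist stays good-ordinary-or-multiplicative at `2`** (CM-free half of
`not_hasCM_and_goodOrd_or_mult_of_smul_eq_quadraticTwist`: `a₂(W') = ±a₂(W)` at a good `2`,
`hasMultiplicativeReductionAtPrime_of_smul_eq_quadraticTwist_two` at a multiplicative `2`).
[cite: SilvermanAEC2009, VII.5 Prop. 5.1, X.5 Cor. 5.4] -/
theorem goodOrd_or_mult_of_smul_eq_quadraticTwist (hred : GoodOrd W 2 ∨ Mult W 2) {d : ℤ} (hd4 : d % 4 = 1)
    {W' : WeierstrassCurve ℚ} [W'.IsElliptic] [W'.IsGloballyMinimal] {C : VariableChange ℚ}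
    (hC : C • W' = W.quadraticTwist (d : ℚ)) : GoodOrd W' 2 ∨ Mult W' 2 := by
  rcases hred with hgo | hm
  · have hgo₀ : W.HasGoodReductionAtPrime 2 ∧ ¬ (2 : ℤ) ∣ W.frobeniusTrace 2 := hgo
    obtain ⟨hgood', htr⟩ :=
      GoldfeldGoodTwists.hasGoodReductionAtPrime_and_frobeniusTrace_of_smul_eq_quadraticTwist_two W W' hd4 hC 2
        rfl hgo₀.1
    refine Or.inl ⟨hgood', ?_⟩
    rw [htr]
    intro h
    apply hgo₀.2
    split_ifs at h
    · simpa using h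
    · simpa using h
  · exact Or.inr (hasMultiplicativeReductionAtPrime_of_smul_eq_quadraticTwist_two W W' hd4 hC 2 rfl hm)

/-! ## §2 `μ` along an admissible twist family: R₂ ↦ M₂ and M₂ ↦ R₂ under a negative twist -/

/-- **Type R₂ acquires a Prop-5.14 point at every NEGATIVE admissible twist; there `X(·/ℚ_∞)` is `Λ`-torsion with
`μ = 0` (Greenberg Prop. 5.14 BY NAME).**  `W` globally minimal, good-ordinary or multiplicative at `2`, with a rational
point of order `2` that is ramified at `2` AND odd (Prop. 5.13: `μ(W) ≥ 1`) and `Δ(W) > 0`; `d < 0`, `d ≡ 1 (mod 4)`;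
`A` a globally minimal model of `W^{(d)}`.  Then `A` is again good-ordinary or multiplicative at `2`, its twisted point
is ramified and NOT odd, and `h514` applies at `A`. [cite: GreenbergLNM1716, §5 Props. 5.13–5.14 and Remark (chunks p0168–p0174)] -/
theorem isTorsion_mu_eq_zero_twist_of_neg_of_ramified_odd_of_Δ_pos (h514 : prop514_isTorsion_mu_eq_zero_two)
    (hred : GoodOrd W 2 ∨ Mult W 2) {x : ℚ} (hx : HasRationalTwoTorsionX W x) (hR : TwoTorsionRamifiedAtTwo x)
    (hO : TwoTorsionOdd W x) (hΔ : 0 < W.Δ) {d : ℤ} (hd4 : d % 4 = 1) (hd : d < 0)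
    {A : WeierstrassCurve ℚ} [A.IsElliptic] [A.IsGloballyMinimal] {C_A : VariableChange ℚ}
    (hA : C_A • A = W.quadraticTwist (d : ℚ)) :
    (GoodOrd A 2 ∨ Mult A 2) ∧
      (∃ x' : ℚ, HasRationalTwoTorsionX A x' ∧ TwoTorsionRamifiedAtTwo x' ∧ ¬ TwoTorsionOdd A x') ∧
      ∀ (κ : ZpExtension ℚ 2) (γ : Field.absoluteGaloisGroup ℚ), κ.IsCyclotomic → κ.IsTopGenerator γ →
        ∀ D : A.SelmerDualData κ γ, D.IsTorsion ∧ D.mu = 0 := by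
  haveI : Fact (Nat.Prime 2) := ⟨Nat.prime_two⟩
  obtain ⟨y, hEq, h2⟩ := hx
  set C : VariableChange ℚ := ⟨1, x, -W.a₁ / 2, y⟩ with hC
  have hns : W.toAffine.Nonsingular x y := (WeierstrassCurve.Affine.equation_iff_nonsingular).mp hEq
  have hy : y = W.toAffine.negY x y := by
    rw [WeierstrassCurve.Affine.negY]; linear_combination h2
  haveI hNF : (C • W).IsTwoTorsionNF := isTwoTorsionNF_smul_of_two_nsmul_eq_zero two_ne_zero hns hy
  have hred' : GoodOrd A 2 ∨ Mult A 2 := goodOrd_or_mult_of_smul_eq_quadraticTwist W hred hd4 hA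
  have ha₁W := odd_a₁_integralModelInt_of_goodOrd_or_mult W hred
  have ha₁A := odd_a₁_integralModelInt_of_goodOrd_or_mult A hred'
  have hd2 := padicValRat_two_intCast_of_emod_four_eq_one hd4
  have hdq : ((d : ℤ) : ℚ) < 0 := by exact_mod_cast hd
  have hCr : C.r = x := rfl
  obtain ⟨hR', hO', -⟩ := prop514Hypothesis_twist_of_neg_of_ramified_odd_of_Δ_pos W A C C_A (d : ℚ) ha₁W ha₁A
    hA hdq hd2 hΔ (hCr ▸ hR) (hCr ▸ hO)
  obtain ⟨y', hEq', h2'⟩ := hasRationalTwoTorsionX_twist W A C C_A (d : ℚ) hA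
  have hredA : (A.HasGoodReductionAtPrime 2 ∧ ¬ (2 : ℤ) ∣ A.frobeniusTrace 2) ∨
      A.HasMultiplicativeReductionAtPrime 2 := by
    rcases hred' with hgo' | hm'
    · exact Or.inl ⟨hgo'.1, hgo'.2⟩
    · exact Or.inr hm'
  exact ⟨hred', ⟨_, ⟨y', hEq', h2'⟩, hR', hO'⟩, fun κ γ hκ hγ D ↦
    h514 A hredA _ y' hEq' h2' (Or.inl ⟨hR', hO'⟩) κ γ hκ hγ D⟩

/-- **Both ends of an R₂ twist pair, BY NAME**: `μ(W) ≥ 1` for every torsion dual datum of `W` (Prop. 5.13, `h513`) while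
`X(A/ℚ_∞)` is torsion with `μ = 0` (Prop. 5.14, `h514`) at the negative admissible twist `A` — `μ` is NOT constant on
an admissible quadratic twist family of stratum (β), and the `μ = 0` package of the (M)-roads is available on HALF of
the family of every R₂ curve. [cite: GreenbergLNM1716, §5 Props. 5.13–5.14 and the conductor-15 example (pp. 120–124)] -/
theorem one_le_mu_and_twist_mu_eq_zero_of_ramified_odd_of_Δ_pos (h513 : prop513_one_le_mu_two_of_ramified_odd)
    (h514 : prop514_isTorsion_mu_eq_zero_two) (hred : GoodOrd W 2 ∨ Mult W 2) {x : ℚ}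
    (hx : HasRationalTwoTorsionX W x) (hR : TwoTorsionRamifiedAtTwo x) (hO : TwoTorsionOdd W x) (hΔ : 0 < W.Δ)
    {d : ℤ} (hd4 : d % 4 = 1) (hd : d < 0) {A : WeierstrassCurve ℚ} [A.IsElliptic] [A.IsGloballyMinimal]
    {C_A : VariableChange ℚ} (hA : C_A • A = W.quadraticTwist (d : ℚ)) :
    (∀ (κ : ZpExtension ℚ 2) (γ : Field.absoluteGaloisGroup ℚ), κ.IsCyclotomic → κ.IsTopGenerator γ →
        ∀ D : W.SelmerDualData κ γ, D.IsTorsion → 1 ≤ D.mu) ∧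
      ∀ (κ : ZpExtension ℚ 2) (γ : Field.absoluteGaloisGroup ℚ), κ.IsCyclotomic → κ.IsTopGenerator γ →
        ∀ D : A.SelmerDualData κ γ, D.IsTorsion ∧ D.mu = 0 := by
  haveI : Fact (Nat.Prime 2) := ⟨Nat.prime_two⟩
  have hredW : (W.HasGoodReductionAtPrime 2 ∧ ¬ (2 : ℤ) ∣ W.frobeniusTrace 2) ∨
      W.HasMultiplicativeReductionAtPrime 2 := by
    rcases hred with hgo | hm
    · exact Or.inl ⟨hgo.1, hgo.2⟩
    · exact Or.inr hm
  obtain ⟨y, hEq, h2⟩ := hx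
  exact ⟨fun κ γ hκ hγ D hX ↦ h513 W hredW x y hEq h2 hR hO κ γ hκ hγ D hX,
    (isTorsion_mu_eq_zero_twist_of_neg_of_ramified_odd_of_Δ_pos W h514 hred ⟨y, hEq, h2⟩ hR hO hΔ hd4 hd hA).2.2⟩

/-- **Type M₂'s ramified member acquires a Prop-5.13 point at every NEGATIVE admissible twist; there `μ ≥ 1`
(Prop. 5.13 BY NAME).**  `W` with a ramified, CO-ODD, not odd rational point of order `2` (so `Δ(W) > 0`, the ramified
member of an M₂ pair, `μ(W) = 0` by 5.14); `d < 0`, `d ≡ 1 (mod 4)`; `A` a globally minimal model of `W^{(d)}`.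
[cite: GreenbergLNM1716, §5 Props. 5.13–5.14 and Remark (chunks p0168–p0174)] -/
theorem one_le_mu_twist_of_neg_of_ramified_coodd (h513 : prop513_one_le_mu_two_of_ramified_odd)
    (hred : GoodOrd W 2 ∨ Mult W 2) {x : ℚ} (hx : HasRationalTwoTorsionX W x) (hR : TwoTorsionRamifiedAtTwo x)
    (hco : ∀ r : ℝ, 4 * r ^ 3 + (W.b₂ : ℝ) * r ^ 2 + 2 * (W.b₄ : ℝ) * r + (W.b₆ : ℝ) = 0 → r ≤ (x : ℝ))
    {d : ℤ} (hd4 : d % 4 = 1) (hd : d < 0) {A : WeierstrassCurve ℚ} [A.IsElliptic] [A.IsGloballyMinimal]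
    {C_A : VariableChange ℚ} (hA : C_A • A = W.quadraticTwist (d : ℚ)) :
    (GoodOrd A 2 ∨ Mult A 2) ∧
      (∃ x' : ℚ, HasRationalTwoTorsionX A x' ∧ TwoTorsionRamifiedAtTwo x' ∧ TwoTorsionOdd A x') ∧
      ∀ (κ : ZpExtension ℚ 2) (γ : Field.absoluteGaloisGroup ℚ), κ.IsCyclotomic → κ.IsTopGenerator γ →
        ∀ D : A.SelmerDualData κ γ, D.IsTorsion → 1 ≤ D.mu := by
  haveI : Fact (Nat.Prime 2) := ⟨Nat.prime_two⟩
  obtain ⟨y, hEq, h2⟩ := hx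
  set C : VariableChange ℚ := ⟨1, x, -W.a₁ / 2, y⟩ with hC
  have hns : W.toAffine.Nonsingular x y := (WeierstrassCurve.Affine.equation_iff_nonsingular).mp hEq
  have hy : y = W.toAffine.negY x y := by
    rw [WeierstrassCurve.Affine.negY]; linear_combination h2
  haveI hNF : (C • W).IsTwoTorsionNF := isTwoTorsionNF_smul_of_two_nsmul_eq_zero two_ne_zero hns hy
  have hred' : GoodOrd A 2 ∨ Mult A 2 := goodOrd_or_mult_of_smul_eq_quadraticTwist W hred hd4 hA
  have ha₁W := odd_a₁_integralModelInt_of_goodOrd_or_mult W hred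
  have ha₁A := odd_a₁_integralModelInt_of_goodOrd_or_mult A hred'
  have hd2 := padicValRat_two_intCast_of_emod_four_eq_one hd4
  have hdq : ((d : ℤ) : ℚ) < 0 := by exact_mod_cast hd
  have hCr : C.r = x := rfl
  obtain ⟨hR', hO'⟩ := ramified_and_odd_twist_of_neg_of_ramified_coodd W A C C_A (d : ℚ) ha₁W ha₁A hA hdq hd2
    (hCr ▸ hR) (hCr ▸ hco)
  obtain ⟨y', hEq', h2'⟩ := hasRationalTwoTorsionX_twist W A C C_A (d : ℚ) hA
  have hredA : (A.HasGoodReductionAtPrime 2 ∧ ¬ (2 : ℤ) ∣ A.frobeniusTrace 2) ∨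
      A.HasMultiplicativeReductionAtPrime 2 := by
    rcases hred' with hgo' | hm'
    · exact Or.inl ⟨hgo'.1, hgo'.2⟩
    · exact Or.inr hm'
  exact ⟨hred', ⟨_, ⟨y', hEq', h2'⟩, hR', hO'⟩, fun κ γ hκ hγ D hX ↦
    h513 A hredA _ y' hEq' h2' hR' hO' κ γ hκ hγ D hX⟩

/-! ## §3 The atoms A₁ / A₂ / A₃ of stratum (β) are closed under admissible twists (between minimal models) -/

section Twist

variable {W}
variable {A : WeierstrassCurve ℚ} [A.IsElliptic] [A.IsGloballyMinimal] {C_A : VariableChange ℚ} {d : ℤ}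

/-- **Atom A₁ is `𝓕`-closed**: if `W` (minimal, good-ordinary or multiplicative at `2`) carries a rational `2`-torsion
point in A₁ («`Δ < 0` ∧ ramified» or «unramified middle») and `A` is a minimal model of `W^{(d)}`, `d ≡ 1 (mod 4)`,
then `A` carries one too (the twisted point, same alternative). [cite: GreenbergLNM1716, §5 Remarks (chunks p0170, p0174)] -/
theorem atom₁_twist (hred : GoodOrd W 2 ∨ Mult W 2) {x : ℚ} (hx : HasRationalTwoTorsionX W x)
    (h : (W.Δ < 0 ∧ TwoTorsionRamifiedAtTwo x) ∨ (¬ TwoTorsionRamifiedAtTwo x ∧ ¬ TwoTorsionOdd W x ∧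
      ¬ ∀ r : ℝ, 4 * r ^ 3 + (W.b₂ : ℝ) * r ^ 2 + 2 * (W.b₄ : ℝ) * r + (W.b₆ : ℝ) = 0 → r ≤ (x : ℝ)))
    (hd4 : d % 4 = 1) (hA : C_A • A = W.quadraticTwist (d : ℚ)) :
    ∃ x' : ℚ, HasRationalTwoTorsionX A x' ∧ ((A.Δ < 0 ∧ TwoTorsionRamifiedAtTwo x') ∨
      (¬ TwoTorsionRamifiedAtTwo x' ∧ ¬ TwoTorsionOdd A x' ∧
        ¬ ∀ r : ℝ, 4 * r ^ 3 + (A.b₂ : ℝ) * r ^ 2 + 2 * (A.b₄ : ℝ) * r + (A.b₆ : ℝ) = 0 → r ≤ (x' : ℝ))) := by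
  haveI : Fact (Nat.Prime 2) := ⟨Nat.prime_two⟩
  obtain ⟨y, hEq, h2⟩ := hx
  set C : VariableChange ℚ := ⟨1, x, -W.a₁ / 2, y⟩ with hC
  have hns : W.toAffine.Nonsingular x y := (WeierstrassCurve.Affine.equation_iff_nonsingular).mp hEq
  have hy : y = W.toAffine.negY x y := by
    rw [WeierstrassCurve.Affine.negY]; linear_combination h2
  haveI hNF : (C • W).IsTwoTorsionNF := isTwoTorsionNF_smul_of_two_nsmul_eq_zero two_ne_zero hns hy
  have hred' : GoodOrd A 2 ∨ Mult A 2 := goodOrd_or_mult_of_smul_eq_quadraticTwist W hred hd4 hA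
  have ha₁W := odd_a₁_integralModelInt_of_goodOrd_or_mult W hred
  have ha₁A := odd_a₁_integralModelInt_of_goodOrd_or_mult A hred'
  have hd2 := padicValRat_two_intCast_of_emod_four_eq_one hd4
  have hd0 : ((d : ℤ) : ℚ) ≠ 0 := by exact_mod_cast (show d ≠ 0 by omega)
  have hCr : C.r = x := rfl
  have hram := twoTorsionRamifiedAtTwo_quadraticTwist_iff W A C C_A (d : ℚ) ha₁W ha₁A hA hd2 hd0
  refine ⟨_, hasRationalTwoTorsionX_twist W A C C_A (d : ℚ) hA, ?_⟩
  rcases h with ⟨hΔ, hR⟩ | ⟨hR, hO, hco⟩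
  · exact Or.inl ⟨(Δ_neg_iff_of_smul_eq_quadraticTwist W A C_A (d : ℚ) hA hd0).mpr hΔ, hram.mpr (hCr ▸ hR)⟩
  · obtain ⟨hO', hco'⟩ := (middle_quadraticTwist_iff W A C C_A (d : ℚ) hA hd0).mpr ⟨hCr ▸ hO, hCr ▸ hco⟩
    exact Or.inr ⟨fun h' ↦ hR (hCr ▸ hram.mp h'), hO', hco'⟩

/-- **Atom A₂ is `𝓕`-closed** («`Δ < 0` ∧ unramified» or «ramified middle»). [cite: GreenbergLNM1716, §5 Remarks (chunks p0170, p0174)] -/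
theorem atom₂_twist (hred : GoodOrd W 2 ∨ Mult W 2) {x : ℚ} (hx : HasRationalTwoTorsionX W x)
    (h : (W.Δ < 0 ∧ ¬ TwoTorsionRamifiedAtTwo x) ∨ (TwoTorsionRamifiedAtTwo x ∧ ¬ TwoTorsionOdd W x ∧
      ¬ ∀ r : ℝ, 4 * r ^ 3 + (W.b₂ : ℝ) * r ^ 2 + 2 * (W.b₄ : ℝ) * r + (W.b₆ : ℝ) = 0 → r ≤ (x : ℝ)))
    (hd4 : d % 4 = 1) (hA : C_A • A = W.quadraticTwist (d : ℚ)) :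
    ∃ x' : ℚ, HasRationalTwoTorsionX A x' ∧ ((A.Δ < 0 ∧ ¬ TwoTorsionRamifiedAtTwo x') ∨
      (TwoTorsionRamifiedAtTwo x' ∧ ¬ TwoTorsionOdd A x' ∧
        ¬ ∀ r : ℝ, 4 * r ^ 3 + (A.b₂ : ℝ) * r ^ 2 + 2 * (A.b₄ : ℝ) * r + (A.b₆ : ℝ) = 0 → r ≤ (x' : ℝ))) := by
  haveI : Fact (Nat.Prime 2) := ⟨Nat.prime_two⟩
  obtain ⟨y, hEq, h2⟩ := hx
  set C : VariableChange ℚ := ⟨1, x, -W.a₁ / 2, y⟩ with hC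
  have hns : W.toAffine.Nonsingular x y := (WeierstrassCurve.Affine.equation_iff_nonsingular).mp hEq
  have hy : y = W.toAffine.negY x y := by
    rw [WeierstrassCurve.Affine.negY]; linear_combination h2
  haveI hNF : (C • W).IsTwoTorsionNF := isTwoTorsionNF_smul_of_two_nsmul_eq_zero two_ne_zero hns hy
  have hred' : GoodOrd A 2 ∨ Mult A 2 := goodOrd_or_mult_of_smul_eq_quadraticTwist W hred hd4 hA
  have ha₁W := odd_a₁_integralModelInt_of_goodOrd_or_mult W hred
  have ha₁A := odd_a₁_integralModelInt_of_goodOrd_or_mult A hred'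
  have hd2 := padicValRat_two_intCast_of_emod_four_eq_one hd4
  have hd0 : ((d : ℤ) : ℚ) ≠ 0 := by exact_mod_cast (show d ≠ 0 by omega)
  have hCr : C.r = x := rfl
  have hram := twoTorsionRamifiedAtTwo_quadraticTwist_iff W A C C_A (d : ℚ) ha₁W ha₁A hA hd2 hd0
  refine ⟨_, hasRationalTwoTorsionX_twist W A C C_A (d : ℚ) hA, ?_⟩
  rcases h with ⟨hΔ, hR⟩ | ⟨hR, hO, hco⟩
  · exact Or.inl ⟨(Δ_neg_iff_of_smul_eq_quadraticTwist W A C_A (d : ℚ) hA hd0).mpr hΔ,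
      fun h' ↦ hR (hCr ▸ hram.mp h')⟩
  · obtain ⟨hO', hco'⟩ := (middle_quadraticTwist_iff W A C C_A (d : ℚ) hA hd0).mpr ⟨hCr ▸ hO, hCr ▸ hco⟩
    exact Or.inr ⟨hram.mpr (hCr ▸ hR), hO', hco'⟩

omit [W.IsGloballyMinimal] [A.IsGloballyMinimal] in
/-- **Atom A₃ is `𝓕`-closed** («`Δ > 0` with an extreme point»; for `d < 0` odd and co-odd are exchanged).
[cite: GreenbergLNM1716, §5 Remarks (chunks p0170, p0174)] -/
theorem atom₃_twist {x : ℚ} (hx : HasRationalTwoTorsionX W x)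
    (h : 0 < W.Δ ∧ (TwoTorsionOdd W x ∨
      ∀ r : ℝ, 4 * r ^ 3 + (W.b₂ : ℝ) * r ^ 2 + 2 * (W.b₄ : ℝ) * r + (W.b₆ : ℝ) = 0 → r ≤ (x : ℝ)))
    (hd4 : d % 4 = 1) (hA : C_A • A = W.quadraticTwist (d : ℚ)) :
    ∃ x' : ℚ, HasRationalTwoTorsionX A x' ∧ 0 < A.Δ ∧ (TwoTorsionOdd A x' ∨
      ∀ r : ℝ, 4 * r ^ 3 + (A.b₂ : ℝ) * r ^ 2 + 2 * (A.b₄ : ℝ) * r + (A.b₆ : ℝ) = 0 → r ≤ (x' : ℝ)) := by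
  obtain ⟨y, hEq, h2⟩ := hx
  set C : VariableChange ℚ := ⟨1, x, -W.a₁ / 2, y⟩ with hC
  have hns : W.toAffine.Nonsingular x y := (WeierstrassCurve.Affine.equation_iff_nonsingular).mp hEq
  have hy : y = W.toAffine.negY x y := by
    rw [WeierstrassCurve.Affine.negY]; linear_combination h2
  haveI hNF : (C • W).IsTwoTorsionNF := isTwoTorsionNF_smul_of_two_nsmul_eq_zero two_ne_zero hns hy
  have hd0 : ((d : ℤ) : ℚ) ≠ 0 := by exact_mod_cast (show d ≠ 0 by omega)
  have hCr : C.r = x := rfl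
  obtain ⟨hΔ, hext⟩ := h
  refine ⟨_, hasRationalTwoTorsionX_twist W A C C_A (d : ℚ) hA,
    (Δ_pos_iff_of_smul_eq_quadraticTwist W A C_A (d : ℚ) hA hd0).mpr hΔ, ?_⟩
  rcases lt_or_gt_of_ne hd0 with hd | hd
  · rcases hext with hO | hco
    · exact Or.inr ((forall_root_le_quadraticTwist_iff_of_neg W A C C_A (d : ℚ) hA hd).mpr (hCr ▸ hO))
    · exact Or.inl ((twoTorsionOdd_quadraticTwist_iff_of_neg W A C C_A (d : ℚ) hA hd).mpr (hCr ▸ hco))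
  · rcases hext with hO | hco
    · exact Or.inl ((twoTorsionOdd_quadraticTwist_iff_of_pos W A C C_A (d : ℚ) hA hd).mpr (hCr ▸ hO))
    · exact Or.inr ((forall_root_le_quadraticTwist_iff_of_pos W A C C_A (d : ℚ) hA hd).mpr (hCr ▸ hco))

end Twist

/-! ## §4 (GEN 20, second pass) The hard core R₁: `μ ≥ 1` along the WHOLE admissible twist family -/

section HardCore

variable {W}
variable {A : WeierstrassCurve ℚ} [A.IsElliptic] [A.IsGloballyMinimal] {C_A : VariableChange ℚ} {d : ℤ}

/-- **Type R₁'s Prop-5.13 member keeps `μ ≥ 1` at EVERY admissible twist** (both signs of `d`): with `Δ(W) < 0` the unique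
rational `2`-torsion point stays ramified AND odd under every admissible twist (`ramified_and_odd_twist_iff_of_Δ_neg`), so
Greenberg's Prop. 5.13 (BY NAME, `h513`) gives `μ ≥ 1` for every torsion dual datum of every minimal model `A` of `W^{(d)}`,
`d ≡ 1 (mod 4)`.  Contrast with type R₂ (`isTorsion_mu_eq_zero_twist_of_neg_of_ramified_odd_of_Δ_pos`: `μ = 0` at every
negative twist): R₁ is the part of the (R) residual on which NO member of the admissible twist family of the 5.13 curve has
`μ = 0` in print. [cite: GreenbergLNM1716, §5 Prop. 5.13 and Remark (chunks p0168, p0170)] -/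
theorem one_le_mu_twist_of_ramified_of_Δ_neg (h513 : prop513_one_le_mu_two_of_ramified_odd)
    (hred : GoodOrd W 2 ∨ Mult W 2) {x : ℚ} (hx : HasRationalTwoTorsionX W x) (hR : TwoTorsionRamifiedAtTwo x)
    (hΔ : W.Δ < 0) (hd4 : d % 4 = 1) (hA : C_A • A = W.quadraticTwist (d : ℚ)) :
    (GoodOrd A 2 ∨ Mult A 2) ∧ A.Δ < 0 ∧
      (∃ x' : ℚ, HasRationalTwoTorsionX A x' ∧ TwoTorsionRamifiedAtTwo x' ∧ TwoTorsionOdd A x') ∧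
      ∀ (κ : ZpExtension ℚ 2) (γ : Field.absoluteGaloisGroup ℚ), κ.IsCyclotomic → κ.IsTopGenerator γ →
        ∀ D : A.SelmerDualData κ γ, D.IsTorsion → 1 ≤ D.mu := by
  haveI : Fact (Nat.Prime 2) := ⟨Nat.prime_two⟩
  obtain ⟨y, hEq, h2⟩ := hx
  set C : VariableChange ℚ := ⟨1, x, -W.a₁ / 2, y⟩ with hC
  have hns : W.toAffine.Nonsingular x y := (WeierstrassCurve.Affine.equation_iff_nonsingular).mp hEq
  have hy : y = W.toAffine.negY x y := by
    rw [WeierstrassCurve.Affine.negY]; linear_combination h2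
  haveI hNF : (C • W).IsTwoTorsionNF := isTwoTorsionNF_smul_of_two_nsmul_eq_zero two_ne_zero hns hy
  have hred' : GoodOrd A 2 ∨ Mult A 2 := goodOrd_or_mult_of_smul_eq_quadraticTwist W hred hd4 hA
  have ha₁W := odd_a₁_integralModelInt_of_goodOrd_or_mult W hred
  have ha₁A := odd_a₁_integralModelInt_of_goodOrd_or_mult A hred'
  have hd2 := padicValRat_two_intCast_of_emod_four_eq_one hd4
  have hd0 : ((d : ℤ) : ℚ) ≠ 0 := by exact_mod_cast (show d ≠ 0 by omega)
  have hCr : C.r = x := rfl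
  have hO : TwoTorsionOdd W C.r := twoTorsionOdd_smul_r_of_Δ_neg W C hΔ
  obtain ⟨hR', hO'⟩ := (ramified_and_odd_twist_iff_of_Δ_neg W A C C_A (d : ℚ) ha₁W ha₁A hA hd0 hd2 hΔ).mpr
    ⟨hCr ▸ hR, hO⟩
  obtain ⟨y', hEq', h2'⟩ := hasRationalTwoTorsionX_twist W A C C_A (d : ℚ) hA
  have hredA : (A.HasGoodReductionAtPrime 2 ∧ ¬ (2 : ℤ) ∣ A.frobeniusTrace 2) ∨
      A.HasMultiplicativeReductionAtPrime 2 := by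
    rcases hred' with hgo' | hm'
    · exact Or.inl ⟨hgo'.1, hgo'.2⟩
    · exact Or.inr hm'
  exact ⟨hred', (Δ_neg_iff_of_smul_eq_quadraticTwist W A C_A (d : ℚ) hA hd0).mpr hΔ, ⟨_, ⟨y', hEq', h2'⟩, hR', hO'⟩,
    fun κ γ hκ hγ D hX ↦ h513 A hredA _ y' hEq' h2' hR' hO' κ γ hκ hγ D hX⟩

/-- **Type M₁'s unramified member (`Δ < 0`, unramified point) keeps a Prop-5.14 point — torsion and `μ = 0` BY NAME (`h514`) —
at EVERY admissible twist.** [cite: GreenbergLNM1716, §5 Prop. 5.14 and Remark (chunks p0168, p0170)] -/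
theorem isTorsion_mu_eq_zero_twist_of_not_ramified_of_Δ_neg (h514 : prop514_isTorsion_mu_eq_zero_two)
    (hred : GoodOrd W 2 ∨ Mult W 2) {x : ℚ} (hx : HasRationalTwoTorsionX W x) (hR : ¬ TwoTorsionRamifiedAtTwo x)
    (hΔ : W.Δ < 0) (hd4 : d % 4 = 1) (hA : C_A • A = W.quadraticTwist (d : ℚ)) :
    (GoodOrd A 2 ∨ Mult A 2) ∧ A.Δ < 0 ∧
      (∃ x' : ℚ, HasRationalTwoTorsionX A x' ∧ ¬ TwoTorsionRamifiedAtTwo x' ∧ TwoTorsionOdd A x') ∧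
      ∀ (κ : ZpExtension ℚ 2) (γ : Field.absoluteGaloisGroup ℚ), κ.IsCyclotomic → κ.IsTopGenerator γ →
        ∀ D : A.SelmerDualData κ γ, D.IsTorsion ∧ D.mu = 0 := by
  haveI : Fact (Nat.Prime 2) := ⟨Nat.prime_two⟩
  obtain ⟨y, hEq, h2⟩ := hx
  set C : VariableChange ℚ := ⟨1, x, -W.a₁ / 2, y⟩ with hC
  have hns : W.toAffine.Nonsingular x y := (WeierstrassCurve.Affine.equation_iff_nonsingular).mp hEq
  have hy : y = W.toAffine.negY x y := by
    rw [WeierstrassCurve.Affine.negY]; linear_combination h2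
  haveI hNF : (C • W).IsTwoTorsionNF := isTwoTorsionNF_smul_of_two_nsmul_eq_zero two_ne_zero hns hy
  have hred' : GoodOrd A 2 ∨ Mult A 2 := goodOrd_or_mult_of_smul_eq_quadraticTwist W hred hd4 hA
  have ha₁W := odd_a₁_integralModelInt_of_goodOrd_or_mult W hred
  have ha₁A := odd_a₁_integralModelInt_of_goodOrd_or_mult A hred'
  have hd2 := padicValRat_two_intCast_of_emod_four_eq_one hd4
  have hd0 : ((d : ℤ) : ℚ) ≠ 0 := by exact_mod_cast (show d ≠ 0 by omega)
  have hCr : C.r = x := rfl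
  obtain ⟨hram, hO', -⟩ := configuration_quadraticTwist_of_unique_real_root W A C C_A (d : ℚ) ha₁W ha₁A hA hd0
    hd2 (eq_of_twoDivision_root_of_Δ_neg W C hΔ)
  have hR' : ¬ TwoTorsionRamifiedAtTwo ((C_A.u : ℚ) ^ 2 * ((d : ℚ) * C.r) + C_A.r) := fun h ↦ hR (hCr ▸ hram.mp h)
  obtain ⟨y', hEq', h2'⟩ := hasRationalTwoTorsionX_twist W A C C_A (d : ℚ) hA
  have hredA : (A.HasGoodReductionAtPrime 2 ∧ ¬ (2 : ℤ) ∣ A.frobeniusTrace 2) ∨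
      A.HasMultiplicativeReductionAtPrime 2 := by
    rcases hred' with hgo' | hm'
    · exact Or.inl ⟨hgo'.1, hgo'.2⟩
    · exact Or.inr hm'
  exact ⟨hred', (Δ_neg_iff_of_smul_eq_quadraticTwist W A C_A (d : ℚ) hA hd0).mpr hΔ, ⟨_, ⟨y', hEq', h2'⟩, hR', hO'⟩,
    fun κ γ hκ hγ D ↦ h514 A hredA _ y' hEq' h2' (Or.inr ⟨hO', hR'⟩) κ γ hκ hγ D⟩

end HardCore

end Summit.BirchSwinnertonDyer.BirchSwinnertonDyer.Theorems.TwoAdicOffHabitat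

end
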